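import Summits.CriticalPhenomena.SAWScalingLimit.Theorems.LeftRightFKG.Negative.BoxMesh
import Literature.Probability.RandomPlanarGeometry.SelfAvoidingWalk
import Literature.Probability.RandomPlanarGeometry.SAWBridgeRadius
import HarnessLib

/-!
# Negative knowledge on crux `LeftRightFKG` (stmt-CriticalPhenomena-11232): boundary adjacency of the marked points is load-bearing

**`leftRightFKG_false_without_boundaryAdjacency`**: the crux statement `LeftRightFKG` of route
`SAWLeftRightFKG` with its endpoint hypotheses `a' ∈ C.support`, `b' ∈ C.support`, `Adj a a'`,
`Adj b b'` dropped — everything else verbatim, INCLUDING the critical weight `x_c^{|γ|}` — is FALSE.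
The witness is fugacity-free: `δ = 1`, `C` = the boundary walk of `[-1,5] × [-1,4]` (so
`Ω_1 = {0,…,4} × {0,…,3}`, proved: `meshVertices_Ωb`, `meshDomain_Ωb`), interior marked points
`a = (1,2)`, `b = (3,2)`, and the `le`-up-closures `A = ↑α`, `B = ↑β` (`Relation.ReflTransGen`) of two
spiralling chords; `A ∩ B = ∅` while `w(A), w(B) > 0`, so `w(A)w(B) ≤ w(univ)w(A∩B) = 0` fails.

Tools proved on the way (reusable for this crux — they compute the crux's ORDER combinatorially):
* `crossInc_edge`, `crossInc_poly`: the crossing defect (`Path.crossInc`, `ArgumentIncrement.lean`) of a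
  unit lattice edge / lattice polyline relative to the vertical probe from a face centre;
* **`wind_poly_probeL`**: the winding number of a CLOSED lattice polyline (the `Set.IccExtend` of
  `SimpleGraph.Walk.toCurve`, i.e. exactly the loop of the crux) about the centre of the face `(m,k)`
  equals minus its signed count of crossings of the upward probe (`pathCross`/`wcross`);
* **`wcross_le_of_wind_nonneg`**: hence `le γ₁ γ₂` (lens loop winds `≥ 0` everywhere) forces
  `wcross m k γ₁ ≤ wcross m k γ₂` for every face — the left–right order is dominance of crossing counts;
* `meshVertices_Ωb`, `meshDomain_Ωb`, `dAdj_iff`: the domain `{wind(C,·) ≠ 0}` of a lattice rectangle is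
  the open rectangle on lattice points (inside: index `1` by the crossing formula and
  `wind_sub_eq_of_mem_connectedComponentIn`; boundary: junk `0`; outside: `wind_sub_eq_zero_of_joined`);
* `no_double_spiral`: the elementary combinatorics (a self-avoiding walk cannot have `(2,2)` as both its
  second and its penultimate vertex unless it has length `2`).

Everything proved, no `sorry`; axioms `propext`, `Classical.choice`, `Quot.sound`. [folklore]
-/


noncomputable section

open Real Set Complex Literature.Probability.LatticeModels Literature.Probability.RandomPlanarGeometry
  Literature.Topology.PlaneTopology

namespace Summit.CriticalPhenomena.SAWScalingLimit.Theorems.LeftRightFKG.Negative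

/-! ## The combinatorial heart: no chord winds twice at both marked points -/

section Spiral

/-- The marked points of the witness (both INTERIOR to the box). [folklore] -/
abbrev a₀ : Site 2 := bx 1 2
/-- `b₀` (auxiliary). [folklore] -/
abbrev b₀ : Site 2 := bx 3 2

local notation "Gb" => discreteDomainGraph Ωb 1

/-- `a₀_mem` (auxiliary). [folklore] -/
theorem a₀_mem : a₀ ∈ boxSet := bx_mem_boxSet (by norm_num)

/-- Indicator sums over lists: vanishing off the list. [folklore] -/
theorem sum_ite_eq_zero {α : Type*} [DecidableEq α] {L : List α} {e : α} (h : e ∉ L) :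
    (L.map fun x => if x = e then (1 : ℤ) else 0).sum = 0 := by
  induction L with
  | nil => simp
  | cons y t ih =>
    rw [List.mem_cons, not_or] at h
    rw [List.map_cons, List.sum_cons, ih h.2, if_neg (Ne.symm h.1)]; simp

/-- Indicator sums over a duplicate-free list are at most `1`. [folklore] -/
theorem sum_ite_le_one {α : Type*} [DecidableEq α] {L : List α} (hL : L.Nodup) (e : α) :
    (L.map fun x => if x = e then (1 : ℤ) else 0).sum ≤ 1 := by
  induction L with
  | nil => simp
  | cons y t ih =>
    rw [List.nodup_cons] at hL
    rw [List.map_cons, List.sum_cons]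
    by_cases h : y = e
    · subst h; rw [if_pos rfl, sum_ite_eq_zero hL.1]; simp
    · rw [if_neg h, zero_add]; exact ih hL.2

/-- A positive indicator sum detects membership. [folklore] -/
theorem mem_of_sum_ite_pos {α : Type*} [DecidableEq α] {L : List α} {e : α}
    (h : 0 < (L.map fun x => if x = e then (1 : ℤ) else 0).sum) : e ∈ L := by
  by_contra hne
  rw [sum_ite_eq_zero hne] at h
  exact lt_irrefl _ h

/-- A unit edge of the box contributes `+1` to `wcross m 1` only if it is one of the two eastward
edges `(m, 2) → (m+1, 2)`, `(m, 3) → (m+1, 3)`. [folklore] -/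
theorem edgeCross_le_ite (m : ℤ) {p q : Site 2} (hp : p ∈ boxSet) :
    edgeCross m 1 p q ≤ (if (p, q) = (bx m 2, bx (m + 1) 2) then 1 else 0) +
      (if (p, q) = (bx m 3, bx (m + 1) 3) then 1 else 0) := by
  unfold edgeCross
  split_ifs with h1 h2 h3 h4 h5 h6 h7 <;> first | omega | skip
  all_goals
    exfalso
    obtain ⟨hp0, hq0, hq1, hk⟩ := h1
    obtain ⟨-, -, h4'⟩ := hp
    have : p 1 = 2 ∨ p 1 = 3 := by omega
    rcases this with h | h
    · apply ‹¬(p, q) = (bx m 2, bx (m + 1) 2)›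
      rw [eq_bx p, eq_bx q, hp0, hq0, hq1, h]
    · apply ‹¬(p, q) = (bx m 3, bx (m + 1) 3)›
      rw [eq_bx p, eq_bx q, hp0, hq0, hq1, h]

/-- `wcross m 1 ≥ 2` forces both eastward edges at heights `2` and `3` of the column `m` to be
darts of the (self-avoiding) walk. [folklore] -/
theorem mem_darts_of_two_le_wcross (m : ℤ) {u v : Site 2} (w : (Gb).Walk u v) (hu : u ∈ boxSet)
    (hp : w.IsPath) (h2 : 2 ≤ wcross m 1 w) :
    (bx m 2, bx (m + 1) 2) ∈ w.darts.map SimpleGraph.Dart.toProd ∧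
      (bx m 3, bx (m + 1) 3) ∈ w.darts.map SimpleGraph.Dart.toProd := by
  set L := w.darts.map SimpleGraph.Dart.toProd with hL
  have hnd : L.Nodup := by
    rw [hL]
    exact List.Nodup.map (fun d₁ d₂ h => SimpleGraph.Dart.ext _ _ h)
      (SimpleGraph.Walk.darts_nodup_of_support_nodup hp.support_nodup)
  have hsum : wcross m 1 w = (L.map fun e => edgeCross m 1 e.1 e.2).sum := by
    rw [wcross_eq_darts, hL, List.map_map]; rfl
  have hle : (L.map fun e => edgeCross m 1 e.1 e.2).sum ≤
      (L.map fun e => (if e = (bx m 2, bx (m + 1) 2) then (1:ℤ) else 0) +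
        (if e = (bx m 3, bx (m + 1) 3) then 1 else 0)).sum := by
    apply List.sum_le_sum
    intro e he
    rw [hL, List.mem_map] at he
    obtain ⟨d, hd, rfl⟩ := he
    have hbox : d.fst ∈ boxSet :=
      support_subset_box w hu _ (SimpleGraph.Walk.dart_fst_mem_support_of_mem_darts w hd)
    exact edgeCross_le_ite m hbox
  rw [List.sum_map_add] at hle
  have c1 := sum_ite_le_one hnd (bx m 2, bx (m + 1) 2)
  have c2 := sum_ite_le_one hnd (bx m 3, bx (m + 1) 3)
  constructor
  · apply mem_of_sum_ite_pos; omega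
  · apply mem_of_sum_ite_pos; omega

/-- In a self-avoiding walk a dart starting at the initial vertex is the first dart. [folklore] -/
theorem eq_of_cons_isPath {u v x y : Site 2} (h : (Gb).Adj u v) (p : (Gb).Walk v x)
    (hp : (SimpleGraph.Walk.cons h p).IsPath)
    (hy : (u, y) ∈ (SimpleGraph.Walk.cons h p).darts.map SimpleGraph.Dart.toProd) : y = v := by
  rw [SimpleGraph.Walk.darts_cons, List.map_cons, List.mem_cons] at hy
  rcases hy with hy | hy
  · exact (Prod.mk.inj hy).2
  · exfalso
    rw [List.mem_map] at hy
    obtain ⟨d, hd, hdu⟩ := hy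
    have : u ∈ p.support := by
      have := SimpleGraph.Walk.dart_fst_mem_support_of_mem_darts p hd
      rwa [show d.fst = u from (Prod.mk.inj hdu).1] at this
    exact ((SimpleGraph.Walk.cons_isPath_iff h p).1 hp).2 this

/-- **No self-avoiding walk from `(1,2)` to `(3,2)` in the box winds twice round both the face
under `(1,2)…(2,3)` and the face under `(2,2)…(3,3)`:** `wcross 1 1 ≥ 2` forces the first step
`(1,2) → (2,2)` and the dart `(1,3) → (2,3)`, `wcross 2 1 ≥ 2` forces the last step
`(2,2) → (3,2)`; a path through `(2,2)` as second AND penultimate vertex has length `2` and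
contains no dart at height `3`. [folklore] -/
theorem no_double_spiral {u v : Site 2} (w : (Gb).Walk u v) (hu : u = a₀) (hv : v = b₀)
    (hp : w.IsPath) (h1 : 2 ≤ wcross 1 1 w) (h2 : 2 ≤ wcross 2 1 w) : False := by
  subst hu
  obtain ⟨hE2, hE3⟩ := mem_darts_of_two_le_wcross 1 w a₀_mem hp h1
  obtain ⟨hF2, -⟩ := mem_darts_of_two_le_wcross 2 w a₀_mem hp h2
  have e12 : (1 : ℤ) + 1 = 2 := by norm_num
  have e23 : (2 : ℤ) + 1 = 3 := by norm_num
  rw [e12] at hE2 hE3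
  rw [e23] at hF2
  cases w with
  | nil => exact absurd hv (by decide)
  | cons h p =>
    rename_i v₁
    have hv₁ : bx 2 2 = v₁ := eq_of_cons_isPath h p hp hE2
    subst hv₁
    have hp' : p.IsPath := ((SimpleGraph.Walk.cons_isPath_iff h p).1 hp).1
    rw [SimpleGraph.Walk.darts_cons, List.map_cons, List.mem_cons] at hF2 hE3
    rcases hF2 with hF2 | hF2
    · exact absurd (Prod.mk.inj hF2).1 (by decide)
    cases p with
    | nil => exact absurd hv (by decide)
    | cons h₂ q =>
      rename_i v₂
      subst hv
      have hv₂ : b₀ = v₂ := eq_of_cons_isPath h₂ q hp' hF2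
      subst hv₂
      have hq : q.IsPath := ((SimpleGraph.Walk.cons_isPath_iff h₂ q).1 hp').1
      have hqnil : q = SimpleGraph.Walk.nil :=
        SimpleGraph.Walk.eq_nil_iff_nil.2 (SimpleGraph.Walk.isPath_iff_nil.1 hq)
      subst hqnil
      rcases hE3 with hE3 | hE3
      · exact absurd (Prod.mk.inj hE3).1 (by decide)
      · rw [SimpleGraph.Walk.darts_cons, List.map_cons, List.mem_cons, SimpleGraph.Walk.darts_nil,
          List.map_nil] at hE3
        rcases hE3 with hE3 | hE3
        · exact absurd (Prod.mk.inj hE3).1 (by decide)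
        · simp at hE3

end Spiral

/-! ## Assembly: left–right PA without boundary adjacency of the endpoints is false -/

section Assembly

open Relation MeasureTheory

local notation "Gb" => discreteDomainGraph Ωb 1

/-- The chord `α`: spirals once (clockwise) round the face under `a₀`. [folklore] -/
def αwalk : (Gb).Walk a₀ b₀ :=
  SimpleGraph.Walk.cons (dadj 1 2 2 2 (by decide) (by decide) (by decide)) (SimpleGraph.Walk.cons (dadj 2 2 2 1 (by decide) (by decide) (by decide)) (SimpleGraph.Walk.cons (dadj 2 1 1 1 (by decide) (by decide) (by decide)) (SimpleGraph.Walk.cons (dadj 1 1 0 1 (by decide) (by decide) (by decide)) (SimpleGraph.Walk.cons (dadj 0 1 0 2 (by decide) (by decide) (by decide)) (SimpleGraph.Walk.cons (dadj 0 2 0 3 (by decide) (by decide) (by decide)) (SimpleGraph.Walk.cons (dadj 0 3 1 3 (by decide) (by decide) (by decide)) (SimpleGraph.Walk.cons (dadj 1 3 2 3 (by decide) (by decide) (by decide)) (SimpleGraph.Walk.cons (dadj 2 3 3 3 (by decide) (by decide) (by decide)) (SimpleGraph.Walk.cons (dadj 3 3 3 2 (by decide) (by decide) (by decide)) (Sim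pleGraph.Walk.nil))))))))))

/-- The chord `β`: spirals once round the face under `b₀`. [folklore] -/
def βwalk : (Gb).Walk a₀ b₀ :=
  SimpleGraph.Walk.cons (dadj 1 2 1 3 (by decide) (by decide) (by decide)) (SimpleGraph.Walk.cons (dadj 1 3 2 3 (by decide) (by decide) (by decide)) (SimpleGraph.Walk.cons (dadj 2 3 3 3 (by decide) (by decide) (by decide)) (SimpleGraph.Walk.cons (dadj 3 3 4 3 (by decide) (by decide) (by decide)) (SimpleGraph.Walk.cons (dadj 4 3 4 2 (by decide) (by decide) (by decide)) (SimpleGraph.Walk.cons (dadj 4 2 4 1 (by decide) (by decide) (by decide)) (SimpleGraph.Walk.cons (dadj 4 1 3 1 (by decide) (by decide) (by decide)) (SimpleGraph.Walk.cons (dadj 3 1 2 1 (by decide) (by decide) (by decide)) (SimpleGraph.Walk.cons (dadj 2 1 2 2 (by decide) (by decide) (by decide)) (SimpleGraph.Walk.cons (dadj 2 2 3 2 (by decide) (by decide) (by decide)) (SimpleGraph.Walk.nil))))))))))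

/-- `αwalk_isPath` (auxiliary). [folklore] -/
theorem αwalk_isPath : αwalk.IsPath := by rw [SimpleGraph.Walk.isPath_def]; decide
/-- `βwalk_isPath` (auxiliary). [folklore] -/
theorem βwalk_isPath : βwalk.IsPath := by rw [SimpleGraph.Walk.isPath_def]; decide
/-- `wcross_α` (auxiliary). [folklore] -/
theorem wcross_α : wcross 1 1 αwalk = 2 := by decide
/-- `wcross_β` (auxiliary). [folklore] -/
theorem wcross_β : wcross 2 1 βwalk = 2 := by decide

/-- A set of chords containing a chord has positive critical weight. [folklore] -/
theorem weight_ne_zero_of_mem {Ω : Set ℂ} {δ : ℝ} {a b : Site 2} {S : Set (SAW.DomainSAW Ω δ a b)}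
    {γ : SAW.DomainSAW Ω δ a b} (hγ : γ ∈ S) : SAW.weight Ω δ a b S ≠ 0 := by
  have hpos : 0 < SAW.weight Ω δ a b {γ} := by
    rw [SAW.weight_singleton, ENNReal.ofReal_pos]
    exact pow_pos SAW.criticalFugacity_pos _
  exact (hpos.trans_le (measure_mono (singleton_subset_iff.2 hγ))).ne'

/-- **Boundary adjacency of the marked points is load-bearing in `LeftRightFKG`
(crux stmt-CriticalPhenomena-11232): the statement with the hypotheses `a' ∈ C.support`,
`b' ∈ C.support`, `Adj a a'`, `Adj b b'` dropped is FALSE, for every positive fugacity.**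
Witness: `δ = 1`, `C` = the boundary of `[-1,5] × [-1,4]` (so `Ω_1 = {0..4} × {0..3}`),
interior endpoints `a = (1,2)`, `b = (3,2)`, `A = ↑α`, `B = ↑β` the `le`-up-closures
(`Relation.ReflTransGen`) of the two spiralling chords; along `le` the crossing counts `wcross`
increase (`wcross_le_of_wind_nonneg`, from the crossing formula `wind_poly_probeL`), so `A`, `B` sit
inside `{wcross₁₁ ≥ 2}`, `{wcross₂₁ ≥ 2}`, which are disjoint (`no_double_spiral`); hence
`w(A) w(B) > 0 = w(univ) w(A ∩ B)`. [folklore] -/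
theorem leftRightFKG_false_without_boundaryAdjacency : ¬ (∀ (δ : ℝ) (c a b : Site 2)
    (C : (zdGraph 2).Walk c c),
    let Ω : Set ℂ := {z | wind (fun t : ℝ => Set.IccExtend zero_le_one (C.toCurve (meshPoint δ)) t - z) ≠ 0}
    let le : SAW.DomainSAW Ω δ a b → SAW.DomainSAW Ω δ a b → Prop := fun γ₁ γ₂ => ∀ z : ℂ,
      0 ≤ wind (fun t : ℝ => Set.IccExtend zero_le_one
        ((γ₁.walk.append γ₂.walk.reverse).toCurve (meshPoint δ)) t - z)
    0 < δ →
    ∀ A B : Set (SAW.DomainSAW Ω δ a b), (∀ γ₁ γ₂, le γ₁ γ₂ → γ₁ ∈ A → γ₂ ∈ A) →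
      (∀ γ₁ γ₂, le γ₁ γ₂ → γ₁ ∈ B → γ₂ ∈ B) →
      SAW.weight Ω δ a b A * SAW.weight Ω δ a b B ≤
        SAW.weight Ω δ a b Set.univ * SAW.weight Ω δ a b (A ∩ B)) := by
  intro h
  have h1 := h 1 c₀ a₀ b₀ Cwalk
  dsimp only at h1
  set le : SAW.DomainSAW Ωb 1 a₀ b₀ → SAW.DomainSAW Ωb 1 a₀ b₀ → Prop := fun γ₁ γ₂ => ∀ z : ℂ,
      0 ≤ wind (fun t : ℝ => Set.IccExtend zero_le_one
        ((γ₁.walk.append γ₂.walk.reverse).toCurve (meshPoint 1)) t - z) with hle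
  let α : SAW.DomainSAW Ωb 1 a₀ b₀ := ⟨αwalk, αwalk_isPath⟩
  let β : SAW.DomainSAW Ωb 1 a₀ b₀ := ⟨βwalk, βwalk_isPath⟩
  let A : Set (SAW.DomainSAW Ωb 1 a₀ b₀) := {γ | ReflTransGen le α γ}
  let B : Set (SAW.DomainSAW Ωb 1 a₀ b₀) := {γ | ReflTransGen le β γ}
  have hA : ∀ γ₁ γ₂, le γ₁ γ₂ → γ₁ ∈ A → γ₂ ∈ A := fun γ₁ γ₂ h12 h1A => ReflTransGen.tail h1A h12
  have hB : ∀ γ₁ γ₂, le γ₁ γ₂ → γ₁ ∈ B → γ₂ ∈ B := fun γ₁ γ₂ h12 h1B => ReflTransGen.tail h1B h12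
  have key : SAW.weight Ωb 1 a₀ b₀ A * SAW.weight Ωb 1 a₀ b₀ B ≤
      SAW.weight Ωb 1 a₀ b₀ Set.univ * SAW.weight Ωb 1 a₀ b₀ (A ∩ B) := h1 one_pos A B hA hB
  -- monotonicity of the crossing counts along `le`
  have hGb : ∀ x y, (Gb).Adj x y → (zdGraph 2).Adj x y := fun _ _ => dAdj_zd
  have hY : ∀ (γ : SAW.DomainSAW Ωb 1 a₀ b₀), ∀ x ∈ γ.walk.support, x 1 ≤ 3 :=
    fun γ x hx => (support_subset_box γ.walk a₀_mem x hx).2.2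
  have mono : ∀ (m : ℤ) (γ₁ γ₂ : SAW.DomainSAW Ωb 1 a₀ b₀), le γ₁ γ₂ →
      wcross m 1 γ₁.walk ≤ wcross m 1 γ₂.walk := fun m γ₁ γ₂ h12 =>
    wcross_le_of_wind_nonneg hGb γ₁.walk γ₂.walk (by norm_num) (hY γ₁) (hY γ₂) (h12 (probeL m 1))
  have hAw : ∀ γ ∈ A, 2 ≤ wcross 1 1 γ.walk := by
    intro γ hγ
    induction hγ with
    | refl => exact wcross_α.symm.le
    | tail _ h12 ih => exact ih.trans (mono 1 _ _ h12)
  have hBw : ∀ γ ∈ B, 2 ≤ wcross 2 1 γ.walk := by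
    intro γ hγ
    induction hγ with
    | refl => exact wcross_β.symm.le
    | tail _ h12 ih => exact ih.trans (mono 2 _ _ h12)
  have hAB : A ∩ B = ∅ := by
    ext γ
    simp only [mem_inter_iff, mem_empty_iff_false, iff_false, not_and]
    intro hγA hγB
    exact no_double_spiral γ.walk rfl rfl γ.isPath (hAw γ hγA) (hBw γ hγB)
  rw [hAB, measure_empty, mul_zero, nonpos_iff_eq_zero, mul_eq_zero] at key
  rcases key with h0 | h0
  · exact weight_ne_zero_of_mem (show α ∈ A from ReflTransGen.refl) h0
  · exact weight_ne_zero_of_mem (show β ∈ B from ReflTransGen.refl) h0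

end Assembly

end Summit.CriticalPhenomena.SAWScalingLimit.Theorems.LeftRightFKG.Negative
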